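import Literature.NumberTheory.GaloisRepresentations.LocalNormQuotientCyclicPlace
import Literature.RingTheory.DiscreteValuationRing.AdicCompletionHensel
import Literature.RingTheory.DiscreteValuationRing.AdicCompletionResidueField
import HarnessLib

/-!
# Principal units under the local norm at a place: a norm which is a principal unit is the norm of a
# principal unit (Teichmüller twist by Hensel's lemma), so `U¹(F_v) ⧸ N_{E_w/F_v} U¹(E_w)` is cyclic for a
# cyclic decomposition group

Topic `NumberTheory/GaloisRepresentations`, namespaces `Literature.NumberTheory.GaloisRepresentations` (§1, one
completion `K_v`) and `….SemiLocal` (§2, a place `w ∣ v` of a Galois extension `E/F` of number fields).  Theorems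
only (no definition, no named fact, no `sorry`).  Cell `bsd-print-cf2`, width seat `bsd-line-cf2c-w3` g14,
`--supports` the deciding class crux stmt-BirchSwinnertonDyer-23300 as a helper: the local atom of the units stub
(U1) runs its devissage on the PRINCIPAL units `A = U¹(E_w)` of the layers; its `T`-cyclicity input is
`U¹(M) ⧸ (… · N_{L/M} U¹(L))` cyclic, which `LocalNormQuotientCyclic(Place)` delivers modulo the clause
«`N x ∈ U¹(M) ⇒ ∃ u ∈ U¹(L), N u = N x`».  This file proves that clause at a place.  HONEST FRAMING: local algebra
over landed files; nothing here closes a crux; BSD is not advanced by this file.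

## What is proved

§1 (`K` a number field, `v` a finite place, `O_v = v.adicCompletionIntegers K`, `κ_v` its residue field,
`n_v = #κ_vˣ`):
* `isUnit_natCast_card_units_residueField` — `n_v` is a unit of `O_v` (`#κ_v = 0` in `κ_v`, so `n_v ≡ -1`);
* `valued_mul_sub_one_lt`, `valued_div_sub_one_lt` — principal units are closed under `·` and `/`;
* ★ `exists_pow_eq_one_and_valued_sub_lt` — **Teichmüller by Hensel**: every `x` with `v(x) = 1` is `≡ ζ (mod 𝔪_v)`
  for an `n_v`-th root of unity `ζ ∈ K_v` (`X^{n_v} - 1` has the simple root `x̄`; `O_v` is henselian, tree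
  `adicCompletionIntegers.henselianLocalRing`);
* ★ `eq_one_of_pow_eq_one_of_valued_sub_one_lt` — a principal unit killed by an integer invertible in `O_v` is `1`
  (`y^n - 1 = (y - 1)·Σ y^i` and `Σ y^i ≡ n` is a unit).

§2 (`F E : Type` number fields, `[IsGalois F E]`, `w : SemiLocal.Place F E v`, `M = F_v`, `L = E_w`):
* `valued_algebraMap_sub_one_lt_iff` — `v_w(z - 1) < 1 ↔ v_v(z - 1) < 1` for `z ∈ F_v`;
* `valued_norm_sub_one_lt` — the norm of a principal unit of `E_w` is a principal unit of `F_v` (product of the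
  conjugates, each a principal unit: `valued_algEquiv_place`);
* ★★ `exists_norm_eq_of_valued_norm_sub_one_lt` — a norm which is a principal unit of `F_v` is the norm of a
  principal unit of `E_w` (`x = u·ζ`, `N ζ` is a principal unit and an `n_w`-th root of unity, hence `1`);
  `forall_norm_mem_exists_principal_place` — THE CLAUSE: for `H ⊆ U¹(F_v)` and `U ⊇ U¹(E_w)`, every norm from
  `E_wˣ` landing in `H` is the norm of an element of `U`;
* ★★ `isCyclic_quotient_place_of_principal_le`, `index_dvd_card_stabilizer_place_of_principal_le` — for `G_w`
  cyclic: `H ⧸ H'` is cyclic and `[H : H'] ∣ #G_w` for every normal `H' ≤ H` containing `H ∩ N_{E_w/F_v}(U)`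
  (`H ⊆ U¹(F_v)`, `U ⊇ U¹(E_w)`) — the `T`-cyclicity input on principal units.

## References
* J.-P. Serre, *Local Fields*, GTM 67, Springer 1979, Ch. V §3 (norms of units and principal units); Ch. II §4
  Prop. 8 (Teichmüller representatives). [SerreLocalFields1979]
* J. Neukirch, *Algebraic Number Theory*, Springer 1999, Ch. II (3.10) (`U = μ_{q-1} × U^{(1)}`), (4.6) (Hensel).
  [NeukirchANT1999]
-/

noncomputable section

open NumberField IsDedekindDomain IsLocalRing Polynomial
open Literature.NumberTheory.Automorphic

namespace Literature.NumberTheory.GaloisRepresentations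

universe u

/-! ## §1. One completion `K_v`: Teichmüller representatives and torsion of principal units -/

section OnePlace

variable (K : Type u) [Field K] [NumberField K] (v : HeightOneSpectrum (𝓞 K))

/-- `#κ_vˣ` is invertible in `O_v`: `#κ_v = 0` in the residue field, so `#κ_vˣ = #κ_v - 1 ≡ -1 (mod 𝔪_v)`.
[cite: NeukirchANT1999, Ch. II §3 Prop. (3.10)] -/
theorem isUnit_natCast_card_units_residueField :
    IsUnit ((Nat.card (ResidueField (v.adicCompletionIntegers K))ˣ : ℕ) : v.adicCompletionIntegers K) := by
  classical
  set O := v.adicCompletionIntegers K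
  set F := ResidueField O
  haveI : Fintype F := Fintype.ofFinite F
  have hn : Nat.card Fˣ = Fintype.card F - 1 := by
    rw [Nat.card_eq_fintype_card, Fintype.card_units]
  have hres : residue O ((Nat.card Fˣ : ℕ) : O) = -1 := by
    rw [map_natCast, hn, Nat.cast_sub Fintype.card_pos, FiniteField.cast_card_eq_zero, Nat.cast_one, zero_sub]
  by_contra h
  have hmem : ((Nat.card Fˣ : ℕ) : O) ∈ maximalIdeal O := (IsLocalRing.mem_maximalIdeal _).mpr (mem_nonunits_iff.mpr h)
  rw [← IsLocalRing.residue_eq_zero_iff, hres, neg_eq_zero] at hmem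
  exact one_ne_zero hmem

/-- A principal unit has valuation `1`: `v(y - 1) < 1 → v(y) = 1` (private copy of the tree's
`valued_eq_one_of_valued_sub_one_lt_one`, whose module is import-heavy). [cite: SerreLocalFields1979, Ch. V §3] -/
private theorem valued_eq_one_of_valued_sub_one_lt {y : v.adicCompletion K} (hy : Valued.v (y - 1) < 1) :
    Valued.v y = 1 := by
  have h := Valuation.map_one_add_of_lt (Valued.v) hy
  rwa [add_sub_cancel] at h

/-- Principal units are closed under multiplication: `v(a-1), v(b-1) < 1 → v(ab - 1) < 1`.
[cite: SerreLocalFields1979, Ch. V §3] -/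
theorem valued_mul_sub_one_lt {a b : v.adicCompletion K} (ha : Valued.v (a - 1) < 1) (hb : Valued.v (b - 1) < 1) :
    Valued.v (a * b - 1) < 1 := by
  have e : a * b - 1 = a * (b - 1) + (a - 1) := by ring
  rw [e]
  refine Valuation.map_add_lt _ ?_ ha
  rw [Valuation.map_mul, valued_eq_one_of_valued_sub_one_lt K v ha, one_mul]
  exact hb

/-- Principal units are closed under division: `v(a-1), v(b-1) < 1 → v(a/b - 1) < 1`.
[cite: SerreLocalFields1979, Ch. V §3] -/
theorem valued_div_sub_one_lt {a b : v.adicCompletion K} (ha : Valued.v (a - 1) < 1) (hb : Valued.v (b - 1) < 1) :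
    Valued.v (a / b - 1) < 1 := by
  have hb1 := valued_eq_one_of_valued_sub_one_lt K v hb
  have hb0 : b ≠ 0 := by
    intro h
    rw [h, map_zero] at hb1
    exact zero_ne_one hb1
  have e : a / b - 1 = ((a - 1) - (b - 1)) / b := by
    rw [div_sub_one hb0, sub_sub_sub_cancel_right]
  rw [e, map_div₀, hb1, div_one]
  exact Valuation.map_sub_lt _ ha hb

/-- **Teichmüller representatives (existence, by Hensel's lemma)**: every `x ∈ K_v` of valuation `1` is congruent
modulo `𝔪_v` to an `n_v`-th root of unity `ζ ∈ K_v`, `n_v = #κ_vˣ` — `X^{n_v} - 1` has the simple root `x̄` in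
`κ_v` and `O_v` is henselian. [cite: SerreLocalFields1979, Ch. II §4 Prop. 8] -/
theorem exists_pow_eq_one_and_valued_sub_lt {x : v.adicCompletion K} (hx : Valued.v x = 1) :
    ∃ ζ : v.adicCompletion K, ζ ^ Nat.card (ResidueField (v.adicCompletionIntegers K))ˣ = 1 ∧
      Valued.v (x - ζ) < 1 := by
  classical
  set O := v.adicCompletionIntegers K
  set F := ResidueField O
  set n := Nat.card Fˣ with hn_def
  have hn0 : n ≠ 0 := Nat.card_pos.ne'
  have hxO : x ∈ O := (HeightOneSpectrum.mem_adicCompletionIntegers (𝓞 K) K v).mpr hx.le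
  set x' : O := ⟨x, hxO⟩
  -- `x'` is a unit of `O`
  have hx'm : x' ∉ maximalIdeal O := by
    intro h
    have h' : Valued.v (x' : v.adicCompletion K) < 1 := (Valuation.mem_maximalIdeal_iff _ _).mp h
    exact absurd hx (ne_of_lt h')
  have hres : residue O x' ≠ 0 := by rwa [Ne, IsLocalRing.residue_eq_zero_iff]
  have hx'u : IsUnit x' := by
    by_contra h
    exact hx'm ((IsLocalRing.mem_maximalIdeal _).mpr (mem_nonunits_iff.mpr h))
  -- Hensel for `X ^ n - 1` at `x'`
  set f : O[X] := X ^ n - C 1 with hf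
  have hmonic : f.Monic := monic_X_pow_sub_C (1 : O) hn0
  have heval : f.eval x' ∈ maximalIdeal O := by
    have hu : (residue O x') ^ n = 1 := by
      have h1 : (Units.mk0 _ hres) ^ n = 1 := pow_card_eq_one'
      have h2 := congrArg ((↑) : Fˣ → F) h1
      rwa [Units.val_pow_eq_pow_val, Units.val_one, Units.val_mk0] at h2
    rw [← IsLocalRing.residue_eq_zero_iff]
    simp [hf, hu]
  have hderiv : IsUnit (f.derivative.eval x') := by
    have : f.derivative.eval x' = (n : O) * x' ^ (n - 1) := by
      simp [hf, derivative_X_pow]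
    rw [this]
    exact (isUnit_natCast_card_units_residueField K v).mul (hx'u.pow _)
  obtain ⟨a, ha, hax⟩ := HenselianLocalRing.is_henselian f hmonic x' heval hderiv
  refine ⟨(a : v.adicCompletion K), ?_, ?_⟩
  · have h : a ^ n = 1 := by
      rw [IsRoot.def, hf, eval_sub, eval_pow, eval_X, eval_C, sub_eq_zero] at ha
      exact ha
    have := congrArg (fun z : O => (z : v.adicCompletion K)) h
    simpa using this
  · have h : Valued.v ((a - x' : O) : v.adicCompletion K) < 1 := (Valuation.mem_maximalIdeal_iff _ _).mp hax
    rw [← Valuation.map_sub_swap]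
    simpa using h

/-- **A principal unit killed by an integer invertible in `O_v` is trivial**: `v(y - 1) < 1`, `y^n = 1`, `n ∈ O_vˣ`
`⟹ y = 1` (`0 = y^n - 1 = (y - 1)·Σ_{i<n} y^i` and `Σ y^i ≡ n (mod 𝔪_v)` is a unit).  In particular `U¹(K_v)` has
no torsion of order prime to the residue characteristic. [cite: NeukirchANT1999, Ch. II §3 Prop. (3.10)] -/
theorem eq_one_of_pow_eq_one_of_valued_sub_one_lt {y : v.adicCompletion K} (hy : Valued.v (y - 1) < 1) {n : ℕ}
    (hn : IsUnit ((n : ℕ) : v.adicCompletionIntegers K)) (h : y ^ n = 1) : y = 1 := by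
  classical
  set O := v.adicCompletionIntegers K
  have hy1 := valued_eq_one_of_valued_sub_one_lt K v hy
  have hyO : y ∈ O := (HeightOneSpectrum.mem_adicCompletionIntegers (𝓞 K) K v).mpr hy1.le
  set y' : O := ⟨y, hyO⟩
  have hy'1 : y' - 1 ∈ maximalIdeal O := by
    apply (Valuation.mem_maximalIdeal_iff _ _).mpr
    simpa using hy
  have hres1 : residue O y' = 1 := by
    have h0 := (IsLocalRing.residue_eq_zero_iff _).mpr hy'1
    rwa [map_sub, map_one, sub_eq_zero] at h0
  have hpow : y' ^ n = 1 := by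
    apply Subtype.ext
    simpa using h
  -- `Σ_{i<n} y'^i` is a unit: its residue is `n ≠ 0`
  have hsum : IsUnit (∑ i ∈ Finset.range n, y' ^ i) := by
    by_contra hns
    have hmem : (∑ i ∈ Finset.range n, y' ^ i) ∈ maximalIdeal O :=
      (IsLocalRing.mem_maximalIdeal _).mpr (mem_nonunits_iff.mpr hns)
    have h0 := (IsLocalRing.residue_eq_zero_iff _).mpr hmem
    rw [map_sum] at h0
    simp only [map_pow, hres1, one_pow, Finset.sum_const, Finset.card_range, nsmul_eq_mul, mul_one] at h0
    have hn' : residue O ((n : ℕ) : O) ≠ 0 := by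
      rw [Ne, IsLocalRing.residue_eq_zero_iff]
      exact fun hm => (mem_nonunits_iff.mp ((IsLocalRing.mem_maximalIdeal _).mp hm)) hn
    exact hn' (by rwa [map_natCast])
  have hzero : (y' - 1) * ∑ i ∈ Finset.range n, y' ^ i = 0 := by
    rw [mul_comm, geom_sum_mul, hpow, sub_self]
  have hy'eq : y' = 1 := sub_eq_zero.mp ((hsum.mul_left_eq_zero).mp hzero)
  exact congrArg Subtype.val hy'eq

end OnePlace

/-! ## §2. A place `w ∣ v` of a Galois extension `E/F`: norms of principal units -/

namespace SemiLocal

variable {F : Type} [Field F] [NumberField F] {E : Type} [Field E] [NumberField E] [Algebra F E]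
variable {v : HeightOneSpectrum (𝓞 F)}

/-- `v_w(z - 1) < 1 ↔ v_v(z - 1) < 1` for `z ∈ F_v ⊆ E_w` (`v_w = v_v^{e(w|v)}` on `F_v`).
[cite: SerreLocalFields1979, Ch. V §3] -/
theorem valued_algebraMap_sub_one_lt_iff (w : Place F E v) (z : v.adicCompletion F) :
    Valued.v (algebraMap (v.adicCompletion F) ((w : HeightOneSpectrum (𝓞 E)).adicCompletion E) z - 1) < 1 ↔
      Valued.v (z - 1) < 1 := by
  rw [← map_one (algebraMap (v.adicCompletion F) ((w : HeightOneSpectrum (𝓞 E)).adicCompletion E)), ← map_sub,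
    algebraMap_place_eq, valued_adicCompletionOfLiesOver]
  exact pow_lt_one_iff (Ideal.IsDedekindDomain.ramificationIdx'_ne_zero_of_liesOver _ v.ne_bot)

/-- **The norm of a principal unit of `E_w` is a principal unit of `F_v`** (`E/F` Galois): `N u = ∏_σ σ u` and each
`σ u` is a principal unit (`σ` preserves `v_w`). [cite: SerreLocalFields1979, Ch. V §3] -/
theorem valued_norm_sub_one_lt [IsGalois F E] (w : Place F E v) {u : (w : HeightOneSpectrum (𝓞 E)).adicCompletion E}
    (hu : Valued.v (u - 1) < 1) :
    Valued.v (Algebra.norm (v.adicCompletion F) u - 1) < 1 := by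
  haveI := finiteDimensional_place (K := F) w
  haveI := isGalois_place w
  rw [← valued_algebraMap_sub_one_lt_iff w, Algebra.norm_eq_prod_automorphisms]
  refine Finset.prod_induction _ (fun y => Valued.v (y - 1) < 1) (fun a b ha hb => ?_) ?_ (fun σ _ => ?_)
  · exact valued_mul_sub_one_lt E (w : HeightOneSpectrum (𝓞 E)) ha hb
  · simp
  · rw [← map_one σ, ← map_sub, valued_algEquiv_place]
    exact hu

/-- ★★ **A norm which is a principal unit is the norm of a principal unit** (`E/F` Galois, `w ∣ v`): if
`N_{E_w/F_v}(x) ∈ U¹(F_v)` then `N x = N u` for some `u ∈ U¹(E_w)`.  Proof: `v_w(x) = 1`; Teichmüller: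
`x ≡ ζ (mod 𝔪_w)` with `ζ^{n_w} = 1`; `u = x/ζ ∈ U¹(E_w)` and `N ζ = N x / N u` is a principal unit with
`(N ζ)^{n_w} = 1`, hence `N ζ = 1`. [cite: SerreLocalFields1979, Ch. V §3] -/
theorem exists_norm_eq_of_valued_norm_sub_one_lt [IsGalois F E] (w : Place F E v)
    {x : (w : HeightOneSpectrum (𝓞 E)).adicCompletion E}
    (hx : Valued.v (Algebra.norm (v.adicCompletion F) x - 1) < 1) :
    ∃ u : (w : HeightOneSpectrum (𝓞 E)).adicCompletion E, Valued.v (u - 1) < 1 ∧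
      Algebra.norm (v.adicCompletion F) u = Algebra.norm (v.adicCompletion F) x := by
  haveI := finiteDimensional_place (K := F) w
  haveI := isGalois_place w
  -- `N x` is a principal unit, so `v_w(x) = 1`
  have hNx1 : Valued.v (Algebra.norm (v.adicCompletion F) x) = 1 := valued_eq_one_of_valued_sub_one_lt F v hx
  have hx1 : Valued.v x = 1 :=
    valuation_eq_one_of_valuation_norm_eq_one ((w : HeightOneSpectrum (𝓞 E)).adicCompletion E) Valued.v
      (valued_algEquiv_place w) ((valued_algebraMap_place_eq_one_iff w _).mpr hNx1)
  -- Teichmüller twist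
  obtain ⟨ζ, hζn, hxζ⟩ := exists_pow_eq_one_and_valued_sub_lt E (w : HeightOneSpectrum (𝓞 E)) hx1
  have hn0 : Nat.card (ResidueField ((w : HeightOneSpectrum (𝓞 E)).adicCompletionIntegers E))ˣ ≠ 0 :=
    Nat.card_pos.ne'
  have hζ1 : Valued.v ζ = 1 := by
    have h := congrArg Valued.v hζn
    rw [map_pow, map_one] at h
    exact le_antisymm ((pow_le_one_iff hn0).mp h.le) ((one_le_pow_iff hn0).mp h.ge)
  have hζ0 : ζ ≠ 0 := by
    intro h
    rw [h, map_zero] at hζ1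
    exact zero_ne_one hζ1
  have hu1 : Valued.v (x / ζ - 1) < 1 := by
    rw [div_sub_one hζ0, map_div₀, hζ1, div_one]
    exact hxζ
  refine ⟨x / ζ, hu1, ?_⟩
  -- `N ζ = 1`: a principal unit of `F_v` which is an `n_w`-th root of unity
  have hNu : Valued.v (Algebra.norm (v.adicCompletion F) (x / ζ) - 1) < 1 := valued_norm_sub_one_lt w hu1
  have hNu0 : Algebra.norm (v.adicCompletion F) (x / ζ) ≠ 0 := by
    intro h0
    have h1 := valued_eq_one_of_valued_sub_one_lt F v hNu
    rw [h0, map_zero] at h1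
    exact zero_ne_one h1
  have hmul : Algebra.norm (v.adicCompletion F) x =
      Algebra.norm (v.adicCompletion F) (x / ζ) * Algebra.norm (v.adicCompletion F) ζ := by
    rw [← map_mul, div_mul_cancel₀ x hζ0]
  have hNζp : Valued.v (Algebra.norm (v.adicCompletion F) ζ - 1) < 1 := by
    have e : Algebra.norm (v.adicCompletion F) ζ =
        Algebra.norm (v.adicCompletion F) x / Algebra.norm (v.adicCompletion F) (x / ζ) := by
      rw [eq_div_iff hNu0, mul_comm, ← hmul]
    rw [e]
    exact valued_div_sub_one_lt F v hx hNu
  have hNζ : Algebra.norm (v.adicCompletion F) ζ = 1 := by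
    apply (algebraMap (v.adicCompletion F) ((w : HeightOneSpectrum (𝓞 E)).adicCompletion E)).injective
    rw [map_one]
    refine eq_one_of_pow_eq_one_of_valued_sub_one_lt E (w : HeightOneSpectrum (𝓞 E))
      ((valued_algebraMap_sub_one_lt_iff w _).mpr hNζp)
      (isUnit_natCast_card_units_residueField E (w : HeightOneSpectrum (𝓞 E))) ?_
    rw [← map_pow, ← map_pow, hζn, map_one, map_one]
  rw [hmul, hNζ, mul_one]

/-- ★★ **THE CLAUSE on principal units**: for `H ≤ F_vˣ` consisting of principal units and `U ≤ E_wˣ` containing the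
principal units, every norm from `E_wˣ` landing in `H` is the norm of an element of `U` (`E/F` Galois) — the
subgroup form of `exists_norm_eq_of_valued_norm_sub_one_lt` consumed by `LocalNormQuotientCyclic`.
[cite: SerreLocalFields1979, Ch. V §3] -/
theorem forall_norm_mem_exists_principal_place [IsGalois F E] (w : Place F E v)
    (H : Subgroup (v.adicCompletion F)ˣ)
    (hH : ∀ y : (v.adicCompletion F)ˣ, y ∈ H → Valued.v ((y : v.adicCompletion F) - 1) < 1)
    (U : Subgroup ((w : HeightOneSpectrum (𝓞 E)).adicCompletion E)ˣ)
    (hU : ∀ x : ((w : HeightOneSpectrum (𝓞 E)).adicCompletion E)ˣ,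
      Valued.v ((x : (w : HeightOneSpectrum (𝓞 E)).adicCompletion E) - 1) < 1 → x ∈ U) :
    ∀ x : ((w : HeightOneSpectrum (𝓞 E)).adicCompletion E)ˣ,
      Units.map (Algebra.norm (v.adicCompletion F)
        (S := (w : HeightOneSpectrum (𝓞 E)).adicCompletion E) :
          (w : HeightOneSpectrum (𝓞 E)).adicCompletion E →* v.adicCompletion F) x ∈ H →
      ∃ u ∈ U, Units.map (Algebra.norm (v.adicCompletion F)
          (S := (w : HeightOneSpectrum (𝓞 E)).adicCompletion E) :
            (w : HeightOneSpectrum (𝓞 E)).adicCompletion E →* v.adicCompletion F) u =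
        Units.map (Algebra.norm (v.adicCompletion F)
          (S := (w : HeightOneSpectrum (𝓞 E)).adicCompletion E) :
            (w : HeightOneSpectrum (𝓞 E)).adicCompletion E →* v.adicCompletion F) x := by
  intro x hx
  have hx' : Valued.v (Algebra.norm (v.adicCompletion F) (x : (w : HeightOneSpectrum (𝓞 E)).adicCompletion E) - 1)
      < 1 := by
    have h := hH _ hx
    rwa [Units.coe_map] at h
  obtain ⟨u, hu1, hu⟩ := exists_norm_eq_of_valued_norm_sub_one_lt w hx'
  have hu0 : u ≠ 0 := by
    intro h
    rw [h, zero_sub, Valuation.map_neg, map_one] at hu1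
    exact lt_irrefl _ hu1
  refine ⟨Units.mk0 u hu0, hU (Units.mk0 u hu0) hu1, Units.ext ?_⟩
  rw [Units.coe_map, Units.coe_map, Units.val_mk0]
  exact hu

/-- ★★ **`U¹(F_v) ⧸ N_{E_w/F_v} U¹(E_w)` and all its quotients are cyclic when the decomposition group `G_w` is cyclic**:
for `H ≤ F_vˣ` of principal units, `U ≤ E_wˣ` containing the principal units, and any normal `H' ≤ H` containing
`H ∩ N_{E_w/F_v}(U)`, `H ⧸ H'` is cyclic (`↪ F_vˣ ⧸ N E_wˣ ≅ Gal(E_w/F_v) ≅ G_w`).  The `T`-cyclicity input of the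
units atom on PRINCIPAL units. [cite: SerreLocalFields1979, Ch. V §3 and Ch. XIII §4 Cor. to Prop. 8] -/
theorem isCyclic_quotient_place_of_principal_le [IsGalois F E] (w : Place F E v)
    [IsCyclic (MulAction.stabilizer (E ≃ₐ[F] E) w)]
    (H : Subgroup (v.adicCompletion F)ˣ)
    (hH : ∀ y : (v.adicCompletion F)ˣ, y ∈ H → Valued.v ((y : v.adicCompletion F) - 1) < 1)
    (U : Subgroup ((w : HeightOneSpectrum (𝓞 E)).adicCompletion E)ˣ)
    (hU : ∀ x : ((w : HeightOneSpectrum (𝓞 E)).adicCompletion E)ˣ,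
      Valued.v ((x : (w : HeightOneSpectrum (𝓞 E)).adicCompletion E) - 1) < 1 → x ∈ U)
    (H' : Subgroup H) [H'.Normal]
    (hle : (U.map (Units.map (Algebra.norm (v.adicCompletion F)
        (S := (w : HeightOneSpectrum (𝓞 E)).adicCompletion E) :
          (w : HeightOneSpectrum (𝓞 E)).adicCompletion E →* v.adicCompletion F))).subgroupOf H ≤ H') :
    IsCyclic (H ⧸ H') := by
  haveI := finiteDimensional_place (K := F) w
  haveI := isGalois_place w
  haveI := isCyclic_gal_place_of_isCyclic w
  exact isCyclic_quotient_of_subgroupOf_map_norm_le (v.adicCompletion F)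
    ((w : HeightOneSpectrum (𝓞 E)).adicCompletion E) H U (forall_norm_mem_exists_principal_place w H hH U hU) H' hle

/-- Index form: `[H : H']` divides `#G_w` under the same hypotheses. [cite: SerreLocalFields1979, Ch. XIII §4 Prop. 9] -/
theorem index_dvd_card_stabilizer_place_of_principal_le [IsGalois F E] (w : Place F E v)
    [IsCyclic (MulAction.stabilizer (E ≃ₐ[F] E) w)]
    (H : Subgroup (v.adicCompletion F)ˣ)
    (hH : ∀ y : (v.adicCompletion F)ˣ, y ∈ H → Valued.v ((y : v.adicCompletion F) - 1) < 1)
    (U : Subgroup ((w : HeightOneSpectrum (𝓞 E)).adicCompletion E)ˣ)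
    (hU : ∀ x : ((w : HeightOneSpectrum (𝓞 E)).adicCompletion E)ˣ,
      Valued.v ((x : (w : HeightOneSpectrum (𝓞 E)).adicCompletion E) - 1) < 1 → x ∈ U)
    (H' : Subgroup H)
    (hle : (U.map (Units.map (Algebra.norm (v.adicCompletion F)
        (S := (w : HeightOneSpectrum (𝓞 E)).adicCompletion E) :
          (w : HeightOneSpectrum (𝓞 E)).adicCompletion E →* v.adicCompletion F))).subgroupOf H ≤ H') :
    H'.index ∣ Nat.card (MulAction.stabilizer (E ≃ₐ[F] E) w) := by
  haveI := finiteDimensional_place (K := F) w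
  haveI := isGalois_place w
  haveI := isCyclic_gal_place_of_isCyclic w
  haveI := isAbelianGalois_of_isCyclic (v.adicCompletion F) ((w : HeightOneSpectrum (𝓞 E)).adicCompletion E)
  rw [← finrank_place_eq_card_stabilizer w]
  exact index_dvd_finrank_of_subgroupOf_range_unitsMap_norm_le (v.adicCompletion F)
    ((w : HeightOneSpectrum (𝓞 E)).adicCompletion E) H H'
    ((subgroupOf_range_le_subgroupOf_map_of_norm_mem (v.adicCompletion F)
      ((w : HeightOneSpectrum (𝓞 E)).adicCompletion E) H U
      (forall_norm_mem_exists_principal_place w H hH U hU)).trans hle)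

end SemiLocal

end Literature.NumberTheory.GaloisRepresentations
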